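import Literature.Topology.FourManifolds.RotationFieldGluing
import Literature.Topology.FourManifolds.ComplementaryFrameTransport
import Literature.Geometry.Symplectic.TwoChartSphereEnergyChart
import Literature.Geometry.Kaehler.ProjectiveLineSymplectic
import HarnessLib

/-!
# The normal planes of an embedded Riemann sphere carry a rotation field

Topic `Literature/Topology/FourManifolds`; sequel to `RotationFieldGluing.lean`. For a smooth
injective immersion `b : ℂℙ¹ → X` of the Riemann sphere (the tree's `ComplexProjectiveSpace 1`,
charted on the literal `EuclideanSpace ℝ (Fin 2)` by
`ComplexProjectiveSpace.instChartedSpaceOne`, a `C^∞` manifold by `CPn.instIsManifoldOne`) into a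
`4`-manifold `X`, read in a Whitney embedding `e : X → V` (`D : CodimTwoData 2 X ℂℙ¹ V`,
`EmbeddedSurfaceNormalPlane.lean`), we **prove** that the field of normal planes
`F y = (TS y)ᗮ ⊓ TX y` carries a rotation field (`CodimTwoData.IsRotationField`), i.e. *the normal
bundle of an embedded `2`-sphere is orientable* — the orientation hypothesis of Kirby's
Theorem VIII.2 (`NullhomotopicNormalFraming.lean`) in the case of spheres:

* `CodimTwoData.exists_isRotationField_projectiveLine`.

Proof. Cover `ℂℙ¹ = A ∪ B` by the two closed unit discs `A = σ₀(|z| ≤ 1)`, `B = σ₁(|z| ≤ 1)` of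
the affine charts `σ₀ z = [1 : z]`, `σ₁ z = [z : 1]` (`linePt`); they meet in the circle
`σ₀(|z| = 1)` (`σ₁ (z⁻¹) = σ₀ z`), which is connected. Over each closed disc the plane bundle
`z ↦ F (σᵢ z)` — the ranges of the smooth family of idempotents `z ↦ Q (σᵢ z)` — has a continuous
frame, by transport of a frame at the centre along rays (the tree's
`exists_contDiffOn_frame_of_projections`, Hirsch Ch. 4 §2 Cor. 2.5: bundles over contractible
bases are trivial); the `2`-form `wedgeForm` of the frame is continuous and non-degenerate on the
normal planes over the disc; and two such form fields over `A` and `B` glue to a rotation field by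
`exists_isRotationField_of_closedCover` (the comparison sign is constant on the connected
circle). Everything here is proved; no named facts are introduced (D-0026).

## References

* M. W. Hirsch, *Differential Topology* (1976), Ch. 4 §2 Cor. 2.5, §4 Lemma 4.1. [HirschDT1976]
* P. Griffiths, J. Harris, *Principles of Algebraic Geometry* (1978), Ch. 0 §2 (the two affine
  charts of `ℂℙ¹`). [GriffithsHarrisPrinciples1978]
-/

open scoped Manifold ContDiff Topology RealInnerProductSpace
open Set Function Module Filter Metric
open Literature.Topology.FourManifolds.ComplexProjectiveSpace Literature.Geometry.Symplectic

noncomputable section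

namespace Literature.Topology.FourManifolds

namespace CodimTwoData

/-! ### The two affine parametrisations `σᵢ : ℂ → ℂℙ¹` -/

section LinePt

/-- The affine parametrisations of the Riemann sphere: `linePt 0 z = [1 : z]`,
`linePt 1 z = [z : 1]` (inverse affine charts composed with `ℂ ≅ ℝ²`). [cite: GriffithsHarrisPrinciples1978, Ch. 0 §2] -/
def linePt (i : Fin 2) (z : ℂ) : ComplexProjectiveSpace 1 :=
  (affineChart (n := 1) i).symm (realCoordinates 1 fun _ => z)

/-- `linePt i` is continuous. [folklore] -/
theorem continuous_linePt (i : Fin 2) : Continuous (linePt i) :=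
  (contMDiff_affineChart_symm_comp i).continuous

/-- The affine coordinate of `linePt i z` is `z`. [folklore] -/
theorem affineCoordComplex_linePt (i : Fin 2) (z : ℂ) : affineCoordComplex i (linePt i z) 0 = z :=
  ComplexProjectiveSpace.affineCoordComplex_affineChart_symm i z

/-- `linePt i z` lies in the chart domain `i`. [folklore] -/
theorem coordNeZero_linePt (i : Fin 2) (z : ℂ) : CoordNeZero i (linePt i z) :=
  ComplexProjectiveSpace.coordNeZero_affineChart_symm i _

/-- A point of the chart domain `i` is `linePt i` of its affine coordinate. [folklore] -/
theorem linePt_affineCoordComplex {i : Fin 2} {p : ComplexProjectiveSpace 1} (hp : CoordNeZero i p) :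
    linePt i (affineCoordComplex i p 0) = p :=
  affineChart_symm_affineCoordComplex hp

/-- `[z⁻¹ : 1] = [1 : z]` for `z ≠ 0`. [folklore] -/
theorem linePt_one_inv {z : ℂ} (hz : z ≠ 0) : linePt 1 z⁻¹ = linePt 0 z :=
  affineChart_one_symm_inv hz

/-- The point at infinity `[0 : 1] = linePt 1 0` is the only point outside the chart `0`.
[folklore] -/
theorem eq_linePt_one_zero {p : ComplexProjectiveSpace 1} (hp : ¬ CoordNeZero 0 p) : p = linePt 1 0 :=
  eq_affineChart_one_symm_of_not_coordNeZero hp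

/-- `[0 : 1]` is not in the chart `0`. [folklore] -/
theorem not_coordNeZero_zero_linePt_one_zero : ¬ CoordNeZero 0 (linePt 1 0) :=
  not_coordNeZero_zero_affineChart_one_symm

/-- **The two closed unit discs meet in the unit circle**:
`σ₀(|z| ≤ 1) ∩ σ₁(|z| ≤ 1) = σ₀(|z| = 1)`. [cite: GriffithsHarrisPrinciples1978, Ch. 0 §2] -/
theorem linePt_image_closedBall_inter :
    linePt 0 '' closedBall (0 : ℂ) 1 ∩ linePt 1 '' closedBall (0 : ℂ) 1 =
      linePt 0 '' sphere (0 : ℂ) 1 := by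
  ext p
  constructor
  · rintro ⟨⟨z, hz, rfl⟩, ⟨z', hz', hzz'⟩⟩
    rw [mem_closedBall, dist_zero_right] at hz hz'
    -- the second affine coordinate of `p = σ₀ z = σ₁ z'` is `z' = z⁻¹`
    have h1 : affineCoordComplex 1 (linePt 0 z) 0 = z' := by
      rw [← hzz']; exact affineCoordComplex_linePt 1 z'
    have h2 : affineCoordComplex 1 (linePt 0 z) 0 = z⁻¹ := by
      rw [affineCoordComplex_one_eq_inv, affineCoordComplex_linePt]
    have hz'eq : z' = z⁻¹ := h1.symm.trans h2
    have hz0 : z ≠ 0 := by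
      intro h0
      rw [h0, inv_zero] at hz'eq
      -- `z' = 0`: then `σ₁ 0 = σ₀ 0`, impossible
      rw [hz'eq, h0] at hzz'
      have h := coordNeZero_linePt 0 0
      rw [← hzz'] at h
      exact not_coordNeZero_zero_linePt_one_zero h
    refine ⟨z, ?_, rfl⟩
    rw [mem_sphere, dist_zero_right]
    refine le_antisymm hz ?_
    have h3 : ‖z⁻¹‖ ≤ 1 := by rw [← hz'eq]; exact hz'
    rw [norm_inv] at h3
    have hzpos : 0 < ‖z‖ := norm_pos_iff.2 hz0
    by_contra hlt
    push Not at hlt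
    have : 1 < ‖z‖⁻¹ := (one_lt_inv₀ hzpos).2 hlt
    linarith
  · rintro ⟨z, hz, rfl⟩
    rw [mem_sphere, dist_zero_right] at hz
    have hz0 : z ≠ 0 := by
      rw [← norm_ne_zero_iff, hz]; exact one_ne_zero
    refine ⟨⟨z, by rw [mem_closedBall, dist_zero_right, hz], rfl⟩, ⟨z⁻¹, ?_, linePt_one_inv hz0⟩⟩
    rw [mem_closedBall, dist_zero_right, norm_inv, hz, inv_one]

/-- **The two closed unit discs cover the sphere.** [cite: GriffithsHarrisPrinciples1978, Ch. 0 §2] -/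
theorem linePt_image_closedBall_union :
    linePt 0 '' closedBall (0 : ℂ) 1 ∪ linePt 1 '' closedBall (0 : ℂ) 1 = univ := by
  refine eq_univ_of_forall fun p => ?_
  by_cases h0 : CoordNeZero 0 p
  · set z := affineCoordComplex 0 p 0 with hz
    have hp : linePt 0 z = p := linePt_affineCoordComplex h0
    by_cases hz1 : ‖z‖ ≤ 1
    · exact Or.inl ⟨z, by rwa [mem_closedBall, dist_zero_right], hp⟩
    · push Not at hz1
      have hz0 : z ≠ 0 := by
        rw [← norm_ne_zero_iff]; exact (zero_lt_one.trans hz1).ne'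
      refine Or.inr ⟨z⁻¹, ?_, by rw [linePt_one_inv hz0, hp]⟩
      rw [mem_closedBall, dist_zero_right, norm_inv]
      exact inv_le_one_of_one_le₀ hz1.le
  · exact Or.inr ⟨0, by simp, (eq_linePt_one_zero h0).symm⟩

/-- The unit circle of the chart `0` is connected. [folklore] -/
theorem isPreconnected_linePt_image_sphere : IsPreconnected (linePt 0 '' sphere (0 : ℂ) 1) := by
  have h : IsConnected (sphere (0 : ℂ) 1) :=
    isConnected_sphere (by rw [Complex.rank_real_complex]; exact Cardinal.one_lt_two) 0 zero_le_one
  exact (h.image _ (continuous_linePt 0).continuousOn).isPreconnected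

end LinePt

/-! ### Frames and form fields over the chart discs -/

section Frames

variable {X : Type*} [TopologicalSpace X] [ChartedSpace (EuclideanSpace ℝ (Fin (2 + 2))) X]
  [IsManifold (𝓡 (2 + 2)) ∞ X]
  {V : Type*} [NormedAddCommGroup V] [InnerProductSpace ℝ V] [FiniteDimensional ℝ V]
  (D : CodimTwoData 2 X (ComplexProjectiveSpace 1) V)

/-- `linePt i` is `C^∞` into `ℂℙ¹` (at the literal model `𝓡 2`). [folklore] -/
theorem contMDiff_linePt (i : Fin 2) : ContMDiff 𝓘(ℝ, ℂ) (𝓡 2) ∞ (linePt i) :=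
  contMDiff_affineChart_symm_comp i

/-- The normal projections along an affine parametrisation form a `C^∞` family of idempotents of
`V` parametrised by `ℂ`. [folklore] -/
theorem contDiff_Q_linePt (i : Fin 2) : ContDiff ℝ ∞ fun z : ℂ => D.Q (linePt i z) :=
  contMDiff_iff_contDiff.1 (D.contMDiff_Q.comp (contMDiff_linePt i))

omit [FiniteDimensional ℝ V] in
/-- The images of the standard basis vectors under an injective `B : ℝ² →L V` are linearly
independent. [folklore] -/
theorem linearIndependent_pair_of_injective {B : EuclideanSpace ℝ (Fin 2) →L[ℝ] V}
    (hB : Injective B) :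
    LinearIndependent ℝ ![B (EuclideanSpace.single 0 1), B (EuclideanSpace.single 1 1)] := by
  refine LinearIndependent.pair_iff.2 fun r u h => ?_
  have h1 : B (r • EuclideanSpace.single 0 1 + u • EuclideanSpace.single 1 1) = 0 := by
    rw [map_add, map_smul, map_smul]; exact h
  have h2 : r • EuclideanSpace.single (0 : Fin 2) (1 : ℝ) + u • EuclideanSpace.single 1 1 = 0 :=
    (injective_iff_map_eq_zero _).1 hB _ h1
  have hr := congrArg (fun v : EuclideanSpace ℝ (Fin 2) => v 0) h2
  have hu := congrArg (fun v : EuclideanSpace ℝ (Fin 2) => v 1) h2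
  simp at hr hu
  exact ⟨hr, hu⟩

/-- **A continuous non-degenerate `2`-form field on the normal planes over a closed chart disc.**
Over `{|z| ≤ 1}` in the chart `i` there is a field `O z` of `2`-forms, continuous on an open
neighbourhood `U` of the disc and non-degenerate on `F (σᵢ z)`: transport a frame of the normal
plane at the centre along rays (`exists_contDiffOn_frame_of_projections` applied to the smooth
idempotent family `z ↦ Q (σᵢ z)`), and take the `2`-form of the frame (`wedgeForm`).
[cite: HirschDT1976, Ch. 4 §2, Cor. 2.5] -/
theorem exists_twoFormField_chart (i : Fin 2) :
    ∃ (U : Set ℂ) (O : ℂ → V [⋀^Fin 2]→L[ℝ] ℝ), IsOpen U ∧ closedBall (0 : ℂ) 1 ⊆ U ∧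
      ContinuousOn O U ∧
        ∀ z ∈ U, ∃ v w, O z ![D.Q (linePt i z) v, D.Q (linePt i z) w] ≠ 0 := by
  -- a frame of the normal plane at the centre
  set y₀ : ComplexProjectiveSpace 1 := linePt i 0 with hy₀
  have hdim : finrank ℝ (EuclideanSpace ℝ (Fin 2)) = finrank ℝ (D.F y₀) := by
    rw [finrank_euclideanSpace_fin]; exact (D.finrank_F_eq_two y₀).symm
  let eqv : EuclideanSpace ℝ (Fin 2) ≃L[ℝ] D.F y₀ := ContinuousLinearEquiv.ofFinrankEq hdim
  let B₀ : EuclideanSpace ℝ (Fin 2) →L[ℝ] V := (D.F y₀).subtypeL.comp (eqv : _ →L[ℝ] _)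
  have hB₀i : Injective B₀ := Subtype.val_injective.comp eqv.injective
  have hB₀f : ∀ w, D.Q (linePt i 0) (B₀ w) = B₀ w := fun w =>
    Submodule.starProjection_eq_self_iff.2 (eqv w).2
  -- transport along rays
  have hP : ContDiffOn ℝ ∞ (fun z : ℂ => D.Q (linePt i z)) univ := (D.contDiff_Q_linePt i).contDiffOn
  have hidem : ∀ z ∈ (univ : Set ℂ), ∀ v : V,
      (fun z : ℂ => D.Q (linePt i z)) z ((fun z : ℂ => D.Q (linePt i z)) z v) =
        (fun z : ℂ => D.Q (linePt i z)) z v :=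
    fun z _ v => D.Q_Q (linePt i z) v
  have hc : (0 : ℂ) ∈ closedBall (0 : ℂ) 1 := mem_closedBall_self zero_le_one
  obtain ⟨U, B, hUo, -, hKU, -, hBs, hB⟩ := exists_contDiffOn_frame_of_projections
    (P := fun z : ℂ => D.Q (linePt i z)) (B₀ := B₀) (isCompact_closedBall (0 : ℂ) 1)
    (convex_closedBall 0 1) isOpen_univ (subset_univ _) hP hidem hc hB₀i hB₀f
  -- the form field of the frame
  refine ⟨U, fun z => wedgeForm (B z (EuclideanSpace.single 0 1)) (B z (EuclideanSpace.single 1 1)),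
    hUo, hKU, ?_, fun z hz => ?_⟩
  · have hBc : ContinuousOn B U := hBs.continuousOn
    have h2 : ContinuousOn (fun z => (B z (EuclideanSpace.single 0 1), B z (EuclideanSpace.single 1 1))) U :=
      (hBc.clm_apply continuousOn_const).prodMk (hBc.clm_apply continuousOn_const)
    have h3 := continuous_wedgeForm.comp_continuousOn h2
    exact h3
  · obtain ⟨hinj, hfix⟩ := hB z hz
    have hmem : ∀ w, B z w ∈ D.F (linePt i z) := fun w =>
      Submodule.starProjection_eq_self_iff.1 (hfix w)
    exact wedgeForm_frame_ne_zero (W := D.F (linePt i z)) (hmem _) (hmem _)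
      (linearIndependent_pair_of_injective hinj)

/-- **The form field of a chart disc, transferred to the sphere**: on the closed disc
`σᵢ(|z| ≤ 1)` the field `p ↦ O (zᵢ(p))` (`zᵢ` the affine coordinate) is continuous and
non-degenerate on the normal planes. [folklore] -/
theorem exists_twoFormField_disc (i : Fin 2) :
    ∃ o : ComplexProjectiveSpace 1 → V [⋀^Fin 2]→L[ℝ] ℝ,
      ContinuousOn o (linePt i '' closedBall (0 : ℂ) 1) ∧
        ∀ p ∈ linePt i '' closedBall (0 : ℂ) 1, ∃ v w, o p ![D.Q p v, D.Q p w] ≠ 0 := by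
  obtain ⟨U, O, -, hKU, hOc, hnd⟩ := D.exists_twoFormField_chart i
  refine ⟨fun p => O (affineCoordComplex i p 0), ?_, ?_⟩
  · have hcoord : ContinuousOn (fun p : ComplexProjectiveSpace 1 => affineCoordComplex i p 0)
        {p | CoordNeZero i p} := (contMDiffOn_affineCoordComplex i).continuousOn
    refine hOc.comp (hcoord.mono ?_) ?_
    · rintro _ ⟨z, -, rfl⟩
      exact coordNeZero_linePt i z
    · rintro _ ⟨z, hz, rfl⟩
      show affineCoordComplex i (linePt i z) 0 ∈ U
      rw [affineCoordComplex_linePt]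
      exact hKU hz
  · rintro _ ⟨z, hz, rfl⟩
    simp only [affineCoordComplex_linePt]
    exact hnd z (hKU hz)

/-- **The normal planes of an embedded Riemann sphere carry a rotation field** (the normal bundle
of an embedded `2`-sphere in a `4`-manifold is orientable): glue the form fields of the two chart
discs over their common boundary circle. [cite: HirschDT1976, Ch. 4 §4, Lemma 4.1] -/
theorem exists_isRotationField_projectiveLine : ∃ J : ComplexProjectiveSpace 1 → V →L[ℝ] V,
    D.IsRotationField J := by
  obtain ⟨oA, hoA, hndA⟩ := D.exists_twoFormField_disc 0
  obtain ⟨oB, hoB, hndB⟩ := D.exists_twoFormField_disc 1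
  have hAc : IsClosed (linePt 0 '' closedBall (0 : ℂ) 1) :=
    ((isCompact_closedBall (0 : ℂ) 1).image (continuous_linePt 0)).isClosed
  have hBc : IsClosed (linePt 1 '' closedBall (0 : ℂ) 1) :=
    ((isCompact_closedBall (0 : ℂ) 1).image (continuous_linePt 1)).isClosed
  have hconn : IsPreconnected (linePt 0 '' closedBall (0 : ℂ) 1 ∩ linePt 1 '' closedBall (0 : ℂ) 1) := by
    rw [linePt_image_closedBall_inter]
    exact isPreconnected_linePt_image_sphere
  exact D.exists_isRotationField_of_closedCover hAc hBc linePt_image_closedBall_union hconn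
    hoA hoB hndA hndB

end Frames

end CodimTwoData

end Literature.Topology.FourManifolds
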